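import Literature.MathematicalPhysics.QuantumFieldTheory.Balaban1983to89.Setup

/-!
# Bałaban's renormalization group for 4-d lattice Yang–Mills — the lattices `T^{(j)}` inside the continuum torus (`TorusGeometry`)

CITATION HEADER (lean-in-tree rule 2026-08-18). Companion to `Setup` (same series, same audit cell `pub-balaban`, unit b2b-balaban-f1):
T. Bałaban, *Comm. Math. Phys.* **109** 249–301 (1987) [Balaban1987RG1] §0, p. 251 (0.1) — the torus
`T_ε = {x ∈ εℤ^d + Σ_μ ½ε e_μ : -L_μ < x_μ < L_μ}`, `ε = L^{-K}`, `L_μ = L^m`, "the lattice points are centres of the ε-cubes" of the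
continuum torus `T = ℝ^d/(2L^m ℤ)^d`, and "this torus determines a sequence of tori `T^{(k)}_{L^kε}` defined by (0.1) with `ε` replaced by
`L^kε` … a point `y ∈ T^{(k)}_{L^kε}` determines a cube of the continuous torus with a center at `y` and the size `L^kε` … `Δ(y)`" —
and p. 252 (0.3) — the blocks `B^k(y) = Δ(y) ∩ (finer lattice)`; contrast T. Bałaban, *Comm. Math. Phys.* **98** 17–51 (1985)
[Balaban1985Averaging] (2) p. 17 (corner-anchored blocks).
WHAT IS REPRODUCED: no theorem of the series. `Setup` types the tori `T^{(j)}` purely combinatorially (`Site P j = Fin d → ZMod (2L^{m+K-j})`,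
integer labels `n`, cell DIVERGENCE.md F2) and the block map / inclusion `blockOf`, `emb` by integer division (F3). This module supplies the
EMBEDDING into the continuum torus that F2 left out — spacing `L^jε`, period `2L^m`, coordinates `x_μ = (n + ½)L^jε - L^m ∈ (-L^m, L^m)`
exactly as printed in (0.1), the map `Site P j → (ℝ/2L^mℤ)^d` — and KERNEL-CHECKS the conventions of `Setup` against the printed ones:
the embedding is injective, one lattice step is translation by `L^jε e_μ`, the inclusion `emb : T^{(j+1)} → T^{(j)}` preserves continuum
coordinates (coarse sites ARE fine sites: centres of centred cubes, `L` odd), `blockOf ∘ emb = id`, and every `x ∈ B(y)` (`y = blockOf x`)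
lies in the cube `Δ(y)` of side `L^{j+1}ε` centred at `y`: `|x_μ - y_μ| ≤ ((L-1)/2)·L^jε` (B12 (0.3), centred convention); and the COUNTS
`|T^{(j)}| = (2L^{m+K-j})^d`, `|B(y)| = L^d` ("the `L^{kd}` points", k = 1), `|T^{(j)}| = L^d·|T^{(j+1)}|` (v1.1). All statements in
the standing range `j ≤ m + K` of `Setup.Params`. Used by the cell's `Missing` module to say "the lattice loop `γ_K` approximates a smooth loop"
without leaving the typed vocabulary. DIVERGENCE.md row F12 records what is still not modelled (the `ℓ¹`/`ℓ^∞` choice in `Site.tdist`,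
continuum cubes as subsets).
-/

open scoped BigOperators
open _root_.MeasureTheory

namespace Literature.MathematicalPhysics.QuantumFieldTheory.Balaban1983to89

/-! ## 1. Spacings and the period (B12 (0.1)) -/

namespace Params

variable (P : Params)

/-- The period `2L_μ = 2L^m` of the continuum torus `T = ℝ^d/(2L^m ℤ)^d` (B12 (0.1): `-L_μ < x_μ < L_μ`, `L_μ = L^m`, boundary identified).
[cite: Balaban1987RG1, (0.1) p.251] -/
noncomputable def period : ℝ := 2 * (P.L : ℝ) ^ P.m

/-- The lattice spacing `L^jε` of `T^{(j)} = T^{(j)}_{L^jε}` (B12 p. 251: "(0.1) with `ε` replaced by `L^kε`"). [cite: Balaban1987RG1, (0.1) p.251] -/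
noncomputable def spacing (j : ℕ) : ℝ := (P.L : ℝ) ^ j * P.eps

/-- `0 < L` as a real number. [folklore] -/
lemma cast_L_pos : (0 : ℝ) < P.L := Nat.cast_pos.mpr P.L_pos

/-- `0 < 2L^m`. [folklore] -/
lemma period_pos : 0 < P.period := by
  unfold period; exact mul_pos two_pos (pow_pos P.cast_L_pos _)

/-- `Fact (0 < period)`, needed by the `AddCircle` API. [folklore] -/
instance : Fact (0 < P.period) := ⟨P.period_pos⟩

/-- `0 < ε`. [folklore] -/
lemma eps_pos : 0 < P.eps := by
  unfold eps; exact pow_pos (inv_pos.mpr P.cast_L_pos) _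

/-- `0 < L^jε`. [folklore] -/
lemma spacing_pos (j : ℕ) : 0 < P.spacing j := by
  unfold spacing; exact mul_pos (pow_pos P.cast_L_pos _) P.eps_pos

/-- The finest lattice `T^{(0)} = T_ε` has spacing `ε`. [cite: Balaban1987RG1, (0.1) p.251] -/
lemma spacing_zero : P.spacing 0 = P.eps := by simp [spacing]

/-- Consecutive spacings differ by the factor `L`. [folklore] -/
lemma spacing_succ (j : ℕ) : P.spacing (j + 1) = P.L * P.spacing j := by
  unfold spacing; rw [pow_succ]; ring

/-- After `K` steps the lattice `T^{(K)}` is the UNIT lattice: `L^K ε = 1` (B12 p. 256: "until we reach the unit lattice").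
[cite: Balaban1987RG1, (0.19) p.256] -/
lemma spacing_K : P.spacing P.K = 1 := by
  unfold spacing eps
  rw [inv_pow, mul_inv_cancel₀ (pow_ne_zero _ P.cast_L_pos.ne')]

/-- `1 < 2L^{m+K-j}`: every torus of the series has at least two sites per direction. [folklore] -/
lemma one_lt_sitesPerDir (j : ℕ) : 1 < P.sitesPerDir j := by
  unfold sitesPerDir
  have : 1 ≤ P.L ^ (P.m + P.K - j) := Nat.one_le_pow _ _ P.L_pos
  omega

/-- `Fact (1 < sitesPerDir j)`, needed for `ZMod.val_one`. [folklore] -/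
instance (j : ℕ) : Fact (1 < P.sitesPerDir j) := ⟨P.one_lt_sitesPerDir j⟩

/-- In the standing range, `T^{(j)}` has `L` times as many sites per direction as `T^{(j+1)}`. [cite: Balaban1987RG1, (0.1) p.251] -/
lemma sitesPerDir_eq_mul_succ {j : ℕ} (hj : j + 1 ≤ P.m + P.K) : P.sitesPerDir j = P.sitesPerDir (j + 1) * P.L := by
  unfold sitesPerDir
  have h : P.m + P.K - j = (P.m + P.K - (j + 1)) + 1 := by omega
  rw [h, pow_succ]; ring

/-- (Number of sites per direction) × (spacing) = period: `2L^{m+K-j} · L^jε = 2L^m` (B12 (0.1)), in the standing range `j ≤ m + K`.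
[cite: Balaban1987RG1, (0.1) p.251] -/
lemma spacing_mul_sitesPerDir {j : ℕ} (hj : j ≤ P.m + P.K) : P.spacing j * (P.sitesPerDir j : ℝ) = P.period := by
  have hL : (P.L : ℝ) ≠ 0 := P.cast_L_pos.ne'
  have h1 : (P.L : ℝ) ^ j * (P.L : ℝ) ^ (P.m + P.K - j) = (P.L : ℝ) ^ P.m * (P.L : ℝ) ^ P.K := by
    rw [← pow_add, ← pow_add]; congr 1; omega
  unfold spacing period sitesPerDir eps
  push_cast
  calc (P.L : ℝ) ^ j * ((P.L : ℝ)⁻¹) ^ P.K * (2 * (P.L : ℝ) ^ (P.m + P.K - j))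
      = 2 * ((P.L : ℝ) ^ j * (P.L : ℝ) ^ (P.m + P.K - j)) * ((P.L : ℝ)⁻¹) ^ P.K := by ring
    _ = 2 * ((P.L : ℝ) ^ P.m * (P.L : ℝ) ^ P.K) * ((P.L : ℝ)⁻¹) ^ P.K := by rw [h1]
    _ = 2 * (P.L : ℝ) ^ P.m := by rw [inv_pow]; field_simp

/-- `L` is odd: the integer half-width `(L-1)/2` of a block is exactly `(L-1)/2` as a real number. [folklore] -/
lemma cast_half_pred_L : (((P.L - 1) / 2 : ℕ) : ℝ) = ((P.L : ℝ) - 1) / 2 := by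
  obtain ⟨k, hk⟩ := P.hL.1
  have h : (P.L - 1) / 2 = k := by omega
  rw [h, hk]; push_cast; ring

end Params

/-! ## 2. Coordinates and the embedding into the continuum torus (B12 (0.1)) -/

/-- The continuum torus `T = ℝ^d/(2L^m ℤ)^d` of B12 (0.1) (the cube `[-L^m, L^m]^d` with opposite faces identified), coordinatewise as
Mathlib's `AddCircle (2L^m)`. [cite: Balaban1987RG1, (0.1) p.251] -/
abbrev CTorus (P : Params) : Type := Fin P.d → AddCircle P.period

namespace Site

variable {P : Params} {j : ℕ}

/-- The real coordinate `x_μ = (n + ½)·L^jε - L^m` of the site with integer label `n = (x μ).val` (B12 (0.1): points of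
`L^jε ℤ^d + Σ ½L^jε e_μ` with `-L^m < x_μ < L^m`, i.e. CENTRES of the `L^jε`-cubes; labels `0, …, 2L^{m+K-j} - 1` from left to right).
[cite: Balaban1987RG1, (0.1) p.251] -/
noncomputable def coord (x : Site P j) (μ : Fin P.d) : ℝ := (((x μ).val : ℝ) + 1 / 2) * P.spacing j - (P.L : ℝ) ^ P.m

/-- The embedding `T^{(j)} ↪ T` of the lattice into the continuum torus (B12 p. 251). [cite: Balaban1987RG1, (0.1) p.251] -/
noncomputable def toTorus (x : Site P j) : CTorus P := fun μ => ((x.coord μ : ℝ) : AddCircle P.period)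

/-- The coordinates satisfy the printed constraint `-L_μ < x_μ < L_μ` of (0.1) (standing range `j ≤ m + K`). [cite: Balaban1987RG1, (0.1) p.251] -/
theorem coord_mem_Ioo (hj : j ≤ P.m + P.K) (x : Site P j) (μ : Fin P.d) :
    x.coord μ ∈ Set.Ioo (-(P.L : ℝ) ^ P.m) ((P.L : ℝ) ^ P.m) := by
  have hs := P.spacing_pos j
  have hv : ((x μ).val : ℝ) + 1 ≤ P.sitesPerDir j := by exact_mod_cast ZMod.val_lt (x μ)
  have hper := P.spacing_mul_sitesPerDir hj
  unfold coord
  constructor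
  · have : 0 < (((x μ).val : ℝ) + 1 / 2) * P.spacing j := by positivity
    linarith
  · have h2 : (((x μ).val : ℝ) + 1 / 2) * P.spacing j < (P.sitesPerDir j : ℝ) * P.spacing j :=
      mul_lt_mul_of_pos_right (by linarith) hs
    rw [mul_comm (P.sitesPerDir j : ℝ), hper] at h2
    unfold Params.period at h2
    linarith

/-- The coordinates lie in the fundamental domain `[-L^m, -L^m + 2L^m)` of the period. [folklore] -/
theorem coord_mem_Ico (hj : j ≤ P.m + P.K) (x : Site P j) (μ : Fin P.d) :
    x.coord μ ∈ Set.Ico (-(P.L : ℝ) ^ P.m) (-(P.L : ℝ) ^ P.m + P.period) := by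
  have h := coord_mem_Ioo hj x μ
  refine ⟨h.1.le, ?_⟩
  unfold Params.period; linarith [h.2]

/-- The embedding `T^{(j)} ↪ T` is injective (standing range `j ≤ m + K`). [cite: Balaban1987RG1, (0.1) p.251] -/
theorem toTorus_injective (hj : j ≤ P.m + P.K) : Function.Injective (toTorus : Site P j → CTorus P) := by
  intro x y hxy
  funext μ
  have h : ((x.coord μ : ℝ) : AddCircle P.period) = ((y.coord μ : ℝ) : AddCircle P.period) := congr_fun hxy μ
  rw [AddCircle.coe_eq_coe_iff_of_mem_Ico (coord_mem_Ico hj x μ) (coord_mem_Ico hj y μ)] at h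
  unfold coord at h
  have hs := (P.spacing_pos j).ne'
  have hval : ((x μ).val : ℝ) = (y μ).val := by
    have := sub_left_injective h
    have := mul_right_cancel₀ hs this
    linarith
  exact ZMod.val_injective _ (by exact_mod_cast hval)

/-- One lattice step `x ↦ x + e_μ` of `Setup.Site.shift` is, in the continuum torus, the translation by `L^jε e_μ` — including across the
identified boundary (standing range `j ≤ m + K`). [cite: Balaban1987RG1, (0.1) p.251] -/
theorem toTorus_shift (hj : j ≤ P.m + P.K) (x : Site P j) (μ : Fin P.d) :
    toTorus (x.shift μ) = toTorus x + Pi.single μ ((P.spacing j : ℝ) : AddCircle P.period) := by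
  funext ν
  by_cases hν : ν = μ
  · subst hν
    simp only [toTorus, Pi.add_apply, Pi.single_eq_same]
    rw [← AddCircle.coe_add]
    -- the label of `x + e_ν` is `(n + 1) mod N`
    have hval : ((x.shift ν) ν).val = ((x ν).val + 1) % P.sitesPerDir j := by
      simp only [shift, Function.update_self]
      rw [ZMod.val_add, ZMod.val_one]
    unfold coord
    rw [hval]
    rcases Nat.lt_or_ge ((x ν).val + 1) (P.sitesPerDir j) with hlt | hge
    · rw [Nat.mod_eq_of_lt hlt]; push_cast; ring_nf
    · -- wrap-around: `n = N - 1`, the new label is `0`, and the coordinates differ by the period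
      have hN : (x ν).val + 1 = P.sitesPerDir j := le_antisymm (ZMod.val_lt (x ν)) hge
      rw [hN, Nat.mod_self]
      have hper := P.spacing_mul_sitesPerDir hj
      have hcast : ((x ν).val : ℝ) = (P.sitesPerDir j : ℝ) - 1 := by
        have : (((x ν).val + 1 : ℕ) : ℝ) = P.sitesPerDir j := by exact_mod_cast hN
        push_cast at this; linarith
      rw [hcast]
      have : ((P.sitesPerDir j : ℝ) - 1 + 1 / 2) * P.spacing j - (P.L : ℝ) ^ P.m + P.spacing j
          = (((0 : ℕ) : ℝ) + 1 / 2) * P.spacing j - (P.L : ℝ) ^ P.m + P.period := by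
        rw [← hper]; push_cast; ring
      rw [this, AddCircle.coe_add_period]
  · simp only [toTorus, Pi.add_apply, Pi.single_eq_of_ne hν, add_zero, coord, shift, Function.update_of_ne hν]

/-! ## 3. The inclusion `T^{(j+1)} ⊂ T^{(j)}` and the blocks (B12 (0.1), (0.3); DIVERGENCE F3) -/

/-- The integer label of the fine site `emb y` is `nL + (L-1)/2` (no reduction modulo the site count occurs; standing range). [folklore] -/
theorem val_emb (hj : j + 1 ≤ P.m + P.K) (y : Site P (j + 1)) (μ : Fin P.d) :
    ((emb y) μ).val = (y μ).val * P.L + (P.L - 1) / 2 := by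
  simp only [emb]
  rw [ZMod.val_natCast, Nat.mod_eq_of_lt]
  have hy : (y μ).val + 1 ≤ P.sitesPerDir (j + 1) := ZMod.val_lt (y μ)
  have h1 : ((y μ).val + 1) * P.L ≤ P.sitesPerDir (j + 1) * P.L := Nat.mul_le_mul_right _ hy
  have h2 : (P.L - 1) / 2 < P.L := by have := P.hL.2; omega
  rw [P.sitesPerDir_eq_mul_succ hj]
  rw [Nat.add_mul, one_mul] at h1
  omega

/-- The label of `blockOf x` is `n / L` (integer division; no reduction modulo the site count occurs; standing range). [folklore] -/
theorem val_blockOf (hj : j + 1 ≤ P.m + P.K) (x : Site P j) (μ : Fin P.d) :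
    ((blockOf x) μ).val = (x μ).val / P.L := by
  simp only [blockOf]
  rw [ZMod.val_natCast, Nat.mod_eq_of_lt]
  rw [Nat.div_lt_iff_lt_mul P.L_pos, ← P.sitesPerDir_eq_mul_succ hj]
  exact ZMod.val_lt (x μ)

/-- COARSE SITES ARE FINE SITES: the inclusion `emb : T^{(j+1)} → T^{(j)}` of `Setup` (label `n ↦ nL + (L-1)/2`) preserves the continuum
coordinates exactly — the centre of a centred cube of odd side `L` (in units of the fine spacing) is a fine lattice point (B12 p. 251).
This is the kernel check of the CENTRED convention recorded in DIVERGENCE F3. [cite: Balaban1987RG1, (0.1) p.251] -/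
theorem coord_emb (hj : j + 1 ≤ P.m + P.K) (y : Site P (j + 1)) (μ : Fin P.d) : (emb y).coord μ = y.coord μ := by
  unfold coord
  rw [val_emb hj, P.spacing_succ]
  push_cast
  rw [P.cast_half_pred_L]
  ring

/-- The embeddings into the continuum torus commute with the inclusion `T^{(j+1)} ⊂ T^{(j)}`. [cite: Balaban1987RG1, (0.1) p.251] -/
theorem toTorus_emb (hj : j + 1 ≤ P.m + P.K) (y : Site P (j + 1)) : toTorus (emb y) = toTorus y := by
  funext μ; simp only [toTorus, coord_emb hj]

/-- `blockOf ∘ emb = id`: a coarse site is the block label of itself viewed as a fine site (standing range). [cite: Balaban1987RG1, (0.3) p.252] -/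
theorem blockOf_emb (hj : j + 1 ≤ P.m + P.K) (y : Site P (j + 1)) : blockOf (emb y) = y := by
  funext μ
  apply ZMod.val_injective
  rw [val_blockOf hj, val_emb hj]
  have h2 : (P.L - 1) / 2 < P.L := by have := P.hL.2; omega
  rw [mul_comm, Nat.mul_add_div P.L_pos, Nat.div_eq_of_lt h2, add_zero]

/-- `y ∈ B(y)`: the centre of a block belongs to it. [cite: Balaban1987RG1, (0.3) p.252] -/
theorem emb_mem_block (hj : j + 1 ≤ P.m + P.K) (y : Site P (j + 1)) : emb y ∈ block y :=
  Finset.mem_filter.mpr ⟨Finset.mem_univ _, blockOf_emb hj y⟩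

/-- `B(y) = Δ(y) ∩ T^{(j)}` (B12 (0.3)): every fine site `x` lies in the continuum cube `Δ(y)` of side `L^{j+1}ε` centred at its block
label `y = blockOf x`, i.e. `|x_μ - y_μ| ≤ ((L-1)/2)·L^jε < ½L^{j+1}ε` coordinatewise. Kernel check that `Setup.blockOf` (integer division by
`L`) is B12's centred block map and not the corner-anchored one of B5/B7 (DIVERGENCE F3). [cite: Balaban1987RG1, (0.3) p.252] -/
theorem abs_coord_sub_coord_blockOf_le (hj : j + 1 ≤ P.m + P.K) (x : Site P j) (μ : Fin P.d) :
    |x.coord μ - (emb (blockOf x)).coord μ| ≤ (((P.L : ℝ) - 1) / 2) * P.spacing j := by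
  have hs := P.spacing_pos j
  have hL1 := P.hL.2
  -- labels: `n = L·(n / L) + n % L`, block centre label `L·(n / L) + (L-1)/2`
  have hlab : (((emb (blockOf x)) μ).val : ℝ) = ((x μ).val / P.L : ℕ) * (P.L : ℝ) + ((P.L : ℝ) - 1) / 2 := by
    rw [val_emb hj, val_blockOf hj]; push_cast; rw [P.cast_half_pred_L]
  have hdiv : ((x μ).val : ℝ) = ((x μ).val / P.L : ℕ) * (P.L : ℝ) + ((x μ).val % P.L : ℕ) := by
    have h := Nat.div_add_mod ((x μ).val) P.L
    have : (((P.L * ((x μ).val / P.L) + (x μ).val % P.L : ℕ)) : ℝ) = (x μ).val := by exact_mod_cast h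
    push_cast at this; linarith
  have hr0 : (0 : ℝ) ≤ ((x μ).val % P.L : ℕ) := Nat.cast_nonneg _
  have hr1 : (((x μ).val % P.L : ℕ) : ℝ) ≤ (P.L : ℝ) - 1 := by
    have : (x μ).val % P.L + 1 ≤ P.L := Nat.mod_lt _ P.L_pos
    have : (((x μ).val % P.L + 1 : ℕ) : ℝ) ≤ P.L := by exact_mod_cast this
    push_cast at this; linarith
  have key : x.coord μ - (emb (blockOf x)).coord μ = ((((x μ).val % P.L : ℕ) : ℝ) - ((P.L : ℝ) - 1) / 2) * P.spacing j := by
    unfold coord; rw [hlab]; nth_rewrite 1 [hdiv]; ring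
  rw [key, abs_mul, abs_of_pos hs]
  refine mul_le_mul_of_nonneg_right ?_ hs.le
  rw [abs_sub_le_iff]
  constructor <;> linarith

/-- The same statement in the continuum torus is not needed: `Δ(y)` never wraps more than the coordinates do. For the record, the side of
`Δ(y)` is the coarse spacing: `2·((L-1)/2)·L^jε + L^jε = L^{j+1}ε`. [folklore] -/
theorem two_mul_half_pred_L_add_one_mul_spacing (j : ℕ) :
    2 * ((((P.L : ℝ) - 1) / 2) * P.spacing j) + P.spacing j = P.spacing (j + 1) := by
  rw [P.spacing_succ]; ring

/-! ## 4. Counts: `|T^{(j)}| = (2L^{m+K-j})^d` and `|B(y)| = L^d` (B12 (0.3): "the `L^{kd}` points") -/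

/-- `|T^{(j)}| = (2L^{m+K-j})^d` — the volume `|T_1^{(k)}|` entering B12 (0.30). [cite: Balaban1987RG1, (0.1) p.251] -/
theorem card_site (P : Params) (j : ℕ) : Fintype.card (Site P j) = P.sitesPerDir j ^ P.d := by
  have h : Fintype.card (Fin P.d → ZMod (P.sitesPerDir j)) = P.sitesPerDir j ^ P.d := by
    rw [Fintype.card_fun, ZMod.card, Fintype.card_fin]
  convert h

/-- The fine site of the block over `y` with offset `r ∈ {0,…,L-1}^d` from the block's lowest label `nL`. [folklore] -/
def blockSite (y : Site P (j + 1)) (r : Fin P.d → Fin P.L) : Site P j :=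
  fun μ => (((y μ).val * P.L + r μ : ℕ) : ZMod (P.sitesPerDir j))

/-- Label of `blockSite y r` is `nL + r` (no wrap-around in the standing range). [folklore] -/
theorem val_blockSite (hj : j + 1 ≤ P.m + P.K) (y : Site P (j + 1)) (r : Fin P.d → Fin P.L) (μ : Fin P.d) :
    ((blockSite y r) μ).val = (y μ).val * P.L + r μ := by
  simp only [blockSite]
  rw [ZMod.val_natCast, Nat.mod_eq_of_lt]
  have hy : (y μ).val + 1 ≤ P.sitesPerDir (j + 1) := ZMod.val_lt (y μ)
  have h1 : ((y μ).val + 1) * P.L ≤ P.sitesPerDir (j + 1) * P.L := Nat.mul_le_mul_right _ hy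
  have h2 := (r μ).isLt
  rw [P.sitesPerDir_eq_mul_succ hj]
  rw [Nat.add_mul, one_mul] at h1
  omega

/-- `blockSite y r ∈ B(y)`. [folklore] -/
theorem blockOf_blockSite (hj : j + 1 ≤ P.m + P.K) (y : Site P (j + 1)) (r : Fin P.d → Fin P.L) :
    blockOf (blockSite y r) = y := by
  funext μ
  apply ZMod.val_injective
  rw [val_blockOf hj, val_blockSite hj, mul_comm, Nat.mul_add_div P.L_pos, Nat.div_eq_of_lt (r μ).isLt, add_zero]

/-- The block over `y` is parametrised bijectively by the offsets `{0,…,L-1}^d`. [folklore] -/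
def blockEquiv (hj : j + 1 ≤ P.m + P.K) (y : Site P (j + 1)) :
    {x : Site P j // blockOf x = y} ≃ (Fin P.d → Fin P.L) where
  toFun x := fun μ => ⟨(x.1 μ).val % P.L, Nat.mod_lt _ P.L_pos⟩
  invFun r := ⟨blockSite y r, blockOf_blockSite hj y r⟩
  left_inv x := by
    obtain ⟨x, hx⟩ := x
    apply Subtype.ext
    funext μ
    apply ZMod.val_injective
    show ((blockSite y fun μ => ⟨(x μ).val % P.L, Nat.mod_lt _ P.L_pos⟩) μ).val = (x μ).val
    rw [val_blockSite hj]
    have h1 : (x μ).val / P.L = (y μ).val := by rw [← val_blockOf hj x μ, hx]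
    have h2 := Nat.div_add_mod ((x μ).val) P.L
    rw [h1] at h2
    simp only
    linarith [h2, mul_comm ((y μ).val) P.L]
  right_inv r := by
    funext μ
    apply Fin.ext
    show ((blockSite y r) μ).val % P.L = (r μ : ℕ)
    rw [val_blockSite hj, Nat.mul_add_mod', Nat.mod_eq_of_lt (r μ).isLt]

/-- `|B(y)| = L^d`: a block of order 1 has exactly `L^d` fine sites (B12 (0.3): `B^k(y)` = "the `L^{kd}` points of the finer lattice";
here `k = 1`), standing range `j + 1 ≤ m + K`. [cite: Balaban1987RG1, (0.3) p.252] -/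
theorem card_block (hj : j + 1 ≤ P.m + P.K) (y : Site P (j + 1)) : (block y).card = P.L ^ P.d := by
  have h : Fintype.card {x : Site P j // blockOf x = y} = P.L ^ P.d := by
    rw [Fintype.card_congr (blockEquiv hj y), Fintype.card_fun, Fintype.card_fin, Fintype.card_fin]
  rw [Fintype.card_subtype] at h
  rw [← h, block]

/-- The blocks partition the fine lattice: `|T^{(j)}| = L^d · |T^{(j+1)}|`. [cite: Balaban1987RG1, (0.3) p.252] -/
theorem card_site_eq_mul_succ (hj : j + 1 ≤ P.m + P.K) :
    Fintype.card (Site P j) = P.L ^ P.d * Fintype.card (Site P (j + 1)) := by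
  rw [card_site, card_site, P.sitesPerDir_eq_mul_succ hj, mul_pow, mul_comm]

end Site

end Literature.MathematicalPhysics.QuantumFieldTheory.Balaban1983to89
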